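import Summits.HodgeConjecture.HodgeConjecture.Theorems.EndoscopicMiddleDegreeAlgebraicOrEnvelopedPureConiveau
import HarnessLib

/-!
# Cruxes `OrthogonalEnveloped` (stmt-HodgeConjecture-14300) and `AlgebraicOrEnveloped` (stmt-HodgeConjecture-14943) from the sibling bet, in the PURE case

`Theorems.EndoscopicMiddleDegreeOrthogonalEnvelopedOfCoreVanishing.orthogonalEnveloped_of_coreVanishing` (p115730) and
`Theorems.EndoscopicMiddleDegreeAlgebraicOrEnvelopedCoreHodgeClassesAlgebraicCalibration.algebraicOrEnveloped_of_coreVanishing`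
(p117875) derive the two cruxes from Grothendieck's coniveau remark `Grothendieck1969_supportedClasses_le_hodgeConiveau`,
`CupProductAlgebraic` and the registered bet `stub_coreVanishing` of line `purity-sorted-hecke-envelope` (crux 14300). The
coniveau remark enters ONLY through the Hodge-type preservation of the Hecke algebras (the hypothesis `hH` of the sieve
`stub_killedBarren`, p96373) and — for 14943 — the algebraic-kernel split; both are re-derived from its PURE CASE
"algebraic classes of codimension `k` are `(k,k)`" in `Theorems/EndoscopicMiddleDegreeAlgebraicOrEnvelopedPureConiveau` (p118246:
`heckeHodgeType_of_pure`, `algebraicKernelSplit_of_pure`, `algebraicOrEnveloped_of_algebraicKernelEnveloped_of_pure`). This file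
records the pure-case versions of the two chains:

* `impureBlocksBarren_of_coreVanishing_of_pure` — NoImpureRationalComponents from the pure case and the bet (p115730's
  `impureBlocksBarren_of_coreVanishing` with `heckeHodgeType_of_pure`);
* `orthogonalEnveloped_of_coreVanishing_of_pure` — crux 14300 from the pure case, `CupProductAlgebraic` and its bet
  (for the lead of 14300: its `stub_grothendieckConiveau` may be weakened to the pure case, which the Wirtinger programme of
  `FundamentalClassNonvanishing` is about to make a theorem);
* `algebraicOrEnveloped_of_coreVanishing_of_pure` — crux 14943 likewise (registered sub-goal of stmt-HodgeConjecture-14943),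
  through `Theorems.algebraicKernelEnveloped_of_orthogonalEnveloped` (p106212, coniveau-free) and the pure glue.

Texts of the bet and of NoImpureRationalComponents are verbatim those of p115730. Nothing here attacks the bet; no definition.

References: BMM arXiv:1306.1515 Part 2 §1.9, Thm. 61; AMR arXiv:1507.01432 §8; Voisin, Hodge Theory I Prop. 11.20, Thm. 6.32.
-/

noncomputable section
set_option linter.dupNamespace false -- `Summit.<P>.<Sub>.Theorems.…` repeats `HodgeConjecture` (single-conjunct summit)

namespace Summit.HodgeConjecture.HodgeConjecture.Theorems.EndoscopicMiddleDegreeAlgebraicOrEnvelopedOfCoreVanishingPure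

open CategoryTheory MonoidalCategory CartesianMonoidalCategory
open Literature.AlgebraicGeometry.Motives (SchemeOver ComplexPoints IsSmoothProjective)
open Literature.AlgebraicGeometry.HodgeTheory
open Literature.AlgebraicGeometry.ShimuraVarieties
open Literature.AlgebraicTopology.SingularHomology
open Summit.HodgeConjecture.HodgeConjecture.Theses.EndoscopicMiddleDegree
  (OrthogonalEnveloped AlgebraicOrEnveloped CupProductAlgebraic)
open Summit.HodgeConjecture.HodgeConjecture.Cruxes.MiddleThetaSpan.ConjugateDimensionSieve (IsPrimitiveCentralIdempotent)
open Summit.HodgeConjecture.HodgeConjecture.Cruxes.OrthogonalEnveloped.PuritySortedHeckeEnvelope (stub_killedBarren)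
open Summit.HodgeConjecture.HodgeConjecture.Theorems.EndoscopicMiddleDegreeOrthogonalEnvelopedOfCoreVanishing
  (orthogonalEnveloped_of_impureBlocksBarren)
open Summit.HodgeConjecture.HodgeConjecture.Theorems.EndoscopicMiddleDegreeAlgebraicOrEnvelopedPureConiveau
  (heckeHodgeType_of_pure algebraicOrEnveloped_of_algebraicKernelEnveloped_of_pure)

/-- **Wide cores barren ⟹ all impure ℚ-blocks barren, from the PURE case of the coniveau remark** (p115730's
`impureBlocksBarren_of_coreVanishing` with `heckeHodgeType_of_pure` feeding the sieve `stub_killedBarren`, p96373, at the complex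
orientation family). [cite: BergeronMillsonMoeglin2016Balls, Part 2 §1.9] [cite: ArancibiaMoeglinRenard2015, §8] -/
theorem impureBlocksBarren_of_coreVanishing_of_pure
    (hA : ∀ ⦃d : ℕ⦄ ⦃Y : SchemeOver ℂ⦄, IsSmoothProjective d Y →
      ∀ (k : ℕ) (x : complexBetti Y (2 * k)), x ∈ algebraicClasses Y k → IsOfHodgeType d Y (2 * k) k k x)
    (hCore : ∀ (m : ℕ) (X : SchemeOver ℂ) (D : UnitaryBallQuotientDatum (2 * (m + 1)) X), 1 ≤ m → m ≤ 2 →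
      ∀ ε : Module.End ℂ (complexBetti X (2 * (m + 1))),
        ε ∈ Algebra.adjoin ℂ (Set.range (D.heckeCorrespondenceAction (2 * (m + 1)))) →
        ε * ε = ε →
        (∀ T ∈ Algebra.adjoin ℂ (Set.range (D.heckeCorrespondenceAction (2 * (m + 1)))),
          T * ε = ε * T) →
        (∀ β, IsRationalClass β → IsRationalClass (ε β)) →
        (∀ f ∈ Algebra.adjoin ℂ (Set.range (D.heckeCorrespondenceAction (2 * (m + 1)))),
          f * f = f →
          (∀ T ∈ Algebra.adjoin ℂ (Set.range (D.heckeCorrespondenceAction (2 * (m + 1)))),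
            T * f = f * T) →
          (∀ β, IsRationalClass β → IsRationalClass (f β)) → f * ε = 0 ∨ f * ε = ε) →
        (∃ β, ¬ IsOfHodgeType (2 * (m + 1)) X (2 * (m + 1)) (m + 1) (m + 1) (ε β)) →
        (∃ z : Module.End ℂ (complexBetti X (2 * (m + 1))),
          IsPrimitiveCentralIdempotent
              (Algebra.adjoin ℂ (Set.range (D.heckeCorrespondenceAction (2 * (m + 1))))) z ∧
            z * ε = z ∧
              ∀ σ : ℂ ≃+* ℂ, ∃ c : complexBetti X (2 * (m + 1)),
                IsOfHodgeType (2 * (m + 1)) X (2 * (m + 1)) (m + 1) (m + 1) (conjEnd σ z c) ∧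
                  conjEnd σ z c ≠ 0) →
        ∀ e : complexBetti X (2 * (m + 1)), IsRationalClass e →
          IsOfHodgeType (2 * (m + 1)) X (2 * (m + 1)) (m + 1) (m + 1) e →
          (∀ x ∈ ((⨆ (W : Submodule D.E (Fin (2 * (m + 1) + 1) → D.E))
              (_ : IsTotallyPositive (conjRingHom D.E) D.H W) (_ : Module.finrank D.E W = m + 1),
              classesSupportedOn X (D.specialSubvariety W) (2 * (m + 1))) ⊔
            (⨆ (W : Submodule D.E (Fin (2 * (m + 1) + 1) → D.E))
              (_ : IsTotallyPositive (conjRingHom D.E) D.H W) (_ : Module.finrank D.E W = m)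
              (Z : Set X.left) (_ : IsClosed Z) (_ : Z ⊆ D.specialSubvariety W)
              (_ : ∀ z ∈ Z, ((m + 1 : ℕ) : ℕ∞) ≤ Order.coheight z),
              classesSupportedOn X Z (2 * (m + 1))) ⊔
            Submodule.span ℂ {z : complexBetti X (2 * (m + 1)) |
              ∃ a : complexBetti X (2 * m), IsRationalClass a ∧
                IsOfHodgeType (2 * (m + 1)) X (2 * m) m m a ∧
                ∃ d ∈ algebraicClasses X 1,
                  z = cupProduct (two_mul_add_two_mul m 1) a d}),
            cupProduct (two_mul_add_two_mul (m + 1) (m + 1)) e x = 0) →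
          ε e = 0) :
    ∀ (m : ℕ) (X : SchemeOver ℂ) (D : UnitaryBallQuotientDatum (2 * (m + 1)) X), 1 ≤ m → m ≤ 2 →
      ∀ ε : Module.End ℂ (complexBetti X (2 * (m + 1))),
        ε ∈ Algebra.adjoin ℂ (Set.range (D.heckeCorrespondenceAction (2 * (m + 1)))) →
        ε * ε = ε →
        (∀ T ∈ Algebra.adjoin ℂ (Set.range (D.heckeCorrespondenceAction (2 * (m + 1)))),
          T * ε = ε * T) →
        (∀ β, IsRationalClass β → IsRationalClass (ε β)) →
        (∀ f ∈ Algebra.adjoin ℂ (Set.range (D.heckeCorrespondenceAction (2 * (m + 1)))),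
          f * f = f →
          (∀ T ∈ Algebra.adjoin ℂ (Set.range (D.heckeCorrespondenceAction (2 * (m + 1)))),
            T * f = f * T) →
          (∀ β, IsRationalClass β → IsRationalClass (f β)) → f * ε = 0 ∨ f * ε = ε) →
        (∃ β, ¬ IsOfHodgeType (2 * (m + 1)) X (2 * (m + 1)) (m + 1) (m + 1) (ε β)) →
        ∀ e : complexBetti X (2 * (m + 1)), IsRationalClass e →
          IsOfHodgeType (2 * (m + 1)) X (2 * (m + 1)) (m + 1) (m + 1) e →
          (∀ x ∈ ((⨆ (W : Submodule D.E (Fin (2 * (m + 1) + 1) → D.E))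
              (_ : IsTotallyPositive (conjRingHom D.E) D.H W) (_ : Module.finrank D.E W = m + 1),
              classesSupportedOn X (D.specialSubvariety W) (2 * (m + 1))) ⊔
            (⨆ (W : Submodule D.E (Fin (2 * (m + 1) + 1) → D.E))
              (_ : IsTotallyPositive (conjRingHom D.E) D.H W) (_ : Module.finrank D.E W = m)
              (Z : Set X.left) (_ : IsClosed Z) (_ : Z ⊆ D.specialSubvariety W)
              (_ : ∀ z ∈ Z, ((m + 1 : ℕ) : ℕ∞) ≤ Order.coheight z),
              classesSupportedOn X Z (2 * (m + 1))) ⊔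
            Submodule.span ℂ {z : complexBetti X (2 * (m + 1)) |
              ∃ a : complexBetti X (2 * m), IsRationalClass a ∧
                IsOfHodgeType (2 * (m + 1)) X (2 * m) m m a ∧
                ∃ d ∈ algebraicClasses X 1,
                  z = cupProduct (two_mul_add_two_mul m 1) a d}),
            cupProduct (two_mul_add_two_mul (m + 1) (m + 1)) e x = 0) →
          ε e = 0 := by
  intro m X D hm1 hm2 ε h1 h2 h3 h4 h5 himp e he hH horth
  obtain ⟨μ, hμ⟩ : ∃ μ : OrientationFamily, μ.HasPoincareDuality :=
    ⟨fun _ _ h ↦ Classical.choice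
        (Literature.AlgebraicGeometry.Motives.ComplexPoints.isOrientableOver ℂ h),
      OrientationFamily.hasPoincareDuality_of
        (fun ν _ _ h ↦ Literature.AlgebraicTopology.SingularHomology.poincare_duality ν h) _⟩
  by_cases hK : ∀ z : Module.End ℂ (complexBetti X (2 * (m + 1))),
      IsPrimitiveCentralIdempotent
          (Algebra.adjoin ℂ (Set.range (D.heckeCorrespondenceAction (2 * (m + 1))))) z →
        z * ε = z →
          ∃ σ : ℂ ≃+* ℂ, ∀ c : complexBetti X (2 * (m + 1)),
            IsOfHodgeType (2 * (m + 1)) X (2 * (m + 1)) (m + 1) (m + 1) (conjEnd σ z c) →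
              conjEnd σ z c = 0
  · -- (K) a KILLED block: barren by the sieve, the Hecke algebra preserving the type `(n,n)` by the pure case
    exact stub_killedBarren m X D hm1 hm2 (fun a ha ↦ heckeHodgeType_of_pure hA hμ D hm1 hm2 ha) ε h1 h2 h3 hK
      e he hH
  · -- (C) a wide CORE: barren by the bet
    push Not at hK
    exact hCore m X D hm1 hm2 ε h1 h2 h3 h4 h5 himp hK e he hH horth

/-- **`OrthogonalEnveloped` (crux stmt-HodgeConjecture-14300) GRANTED the pure case of the coniveau remark, `CupProductAlgebraic`
and its registered bet `stub_coreVanishing` (verbatim)** — p115730's `orthogonalEnveloped_of_coreVanishing` with the named fact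
weakened to its pure case. [cite: BergeronMillsonMoeglin2016Balls, Part 2 §1.9 and Thm. 61] -/
theorem orthogonalEnveloped_of_coreVanishing_of_pure
    (hA : ∀ ⦃d : ℕ⦄ ⦃Y : SchemeOver ℂ⦄, IsSmoothProjective d Y →
      ∀ (k : ℕ) (x : complexBetti Y (2 * k)), x ∈ algebraicClasses Y k → IsOfHodgeType d Y (2 * k) k k x)
    (hcup : CupProductAlgebraic)
    (hCV : ∀ (m : ℕ) (X : SchemeOver ℂ) (D : UnitaryBallQuotientDatum (2 * (m + 1)) X), 1 ≤ m → m ≤ 2 →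
      ∀ ε : Module.End ℂ (complexBetti X (2 * (m + 1))),
        ε ∈ Algebra.adjoin ℂ (Set.range (D.heckeCorrespondenceAction (2 * (m + 1)))) →
        ε * ε = ε →
        (∀ T ∈ Algebra.adjoin ℂ (Set.range (D.heckeCorrespondenceAction (2 * (m + 1)))),
          T * ε = ε * T) →
        (∀ β, IsRationalClass β → IsRationalClass (ε β)) →
        (∀ f ∈ Algebra.adjoin ℂ (Set.range (D.heckeCorrespondenceAction (2 * (m + 1)))),
          f * f = f →
          (∀ T ∈ Algebra.adjoin ℂ (Set.range (D.heckeCorrespondenceAction (2 * (m + 1)))),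
            T * f = f * T) →
          (∀ β, IsRationalClass β → IsRationalClass (f β)) → f * ε = 0 ∨ f * ε = ε) →
        (∃ β, ¬ IsOfHodgeType (2 * (m + 1)) X (2 * (m + 1)) (m + 1) (m + 1) (ε β)) →
        (∃ z : Module.End ℂ (complexBetti X (2 * (m + 1))),
          IsPrimitiveCentralIdempotent
              (Algebra.adjoin ℂ (Set.range (D.heckeCorrespondenceAction (2 * (m + 1))))) z ∧
            z * ε = z ∧
              ∀ σ : ℂ ≃+* ℂ, ∃ c : complexBetti X (2 * (m + 1)),
                IsOfHodgeType (2 * (m + 1)) X (2 * (m + 1)) (m + 1) (m + 1) (conjEnd σ z c) ∧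
                  conjEnd σ z c ≠ 0) →
        ∀ e : complexBetti X (2 * (m + 1)), IsRationalClass e →
          IsOfHodgeType (2 * (m + 1)) X (2 * (m + 1)) (m + 1) (m + 1) e →
          (∀ x ∈ ((⨆ (W : Submodule D.E (Fin (2 * (m + 1) + 1) → D.E))
              (_ : IsTotallyPositive (conjRingHom D.E) D.H W) (_ : Module.finrank D.E W = m + 1),
              classesSupportedOn X (D.specialSubvariety W) (2 * (m + 1))) ⊔
            (⨆ (W : Submodule D.E (Fin (2 * (m + 1) + 1) → D.E))
              (_ : IsTotallyPositive (conjRingHom D.E) D.H W) (_ : Module.finrank D.E W = m)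
              (Z : Set X.left) (_ : IsClosed Z) (_ : Z ⊆ D.specialSubvariety W)
              (_ : ∀ z ∈ Z, ((m + 1 : ℕ) : ℕ∞) ≤ Order.coheight z),
              classesSupportedOn X Z (2 * (m + 1))) ⊔
            Submodule.span ℂ {z : complexBetti X (2 * (m + 1)) |
              ∃ a : complexBetti X (2 * m), IsRationalClass a ∧
                IsOfHodgeType (2 * (m + 1)) X (2 * m) m m a ∧
                ∃ d ∈ algebraicClasses X 1,
                  z = cupProduct (two_mul_add_two_mul m 1) a d}),
            cupProduct (two_mul_add_two_mul (m + 1) (m + 1)) e x = 0) →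
          ε e = 0) :
    OrthogonalEnveloped :=
  orthogonalEnveloped_of_impureBlocksBarren hcup (impureBlocksBarren_of_coreVanishing_of_pure hA hCV)

/-- **`AlgebraicOrEnveloped` (crux stmt-HodgeConjecture-14943) GRANTED the pure case of the coniveau remark,
`CupProductAlgebraic` and crux 14300's registered bet `stub_coreVanishing` (verbatim)** — p117875's registered sub-goal
`algebraicOrEnveloped_of_coreVanishing` with the named fact weakened to its pure case: `orthogonalEnveloped_of_coreVanishing_of_pure`,
then the coniveau-free comparison `Theorems.algebraicKernelEnveloped_of_orthogonalEnveloped` (p106212) and the pure glue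
`algebraicOrEnveloped_of_algebraicKernelEnveloped_of_pure` (p118246). Registered sub-goal of stmt-HodgeConjecture-14943.
[cite: BergeronMillsonMoeglin2016Balls, Part 2 §1.9 and Thm. 61] [cite: VoisinHodgeI2002, Thm. 6.32 and §7.1.2] -/
theorem algebraicOrEnveloped_of_coreVanishing_of_pure :
    (∀ ⦃d : ℕ⦄ ⦃Y : SchemeOver ℂ⦄, IsSmoothProjective d Y →
      ∀ (k : ℕ) (x : complexBetti Y (2 * k)), x ∈ algebraicClasses Y k → IsOfHodgeType d Y (2 * k) k k x) →
    CupProductAlgebraic →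
    (∀ (m : ℕ) (X : SchemeOver ℂ) (D : UnitaryBallQuotientDatum (2 * (m + 1)) X), 1 ≤ m → m ≤ 2 →
      ∀ ε : Module.End ℂ (complexBetti X (2 * (m + 1))),
        ε ∈ Algebra.adjoin ℂ (Set.range (D.heckeCorrespondenceAction (2 * (m + 1)))) →
        ε * ε = ε →
        (∀ T ∈ Algebra.adjoin ℂ (Set.range (D.heckeCorrespondenceAction (2 * (m + 1)))),
          T * ε = ε * T) →
        (∀ β, IsRationalClass β → IsRationalClass (ε β)) →
        (∀ f ∈ Algebra.adjoin ℂ (Set.range (D.heckeCorrespondenceAction (2 * (m + 1)))),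
          f * f = f →
          (∀ T ∈ Algebra.adjoin ℂ (Set.range (D.heckeCorrespondenceAction (2 * (m + 1)))),
            T * f = f * T) →
          (∀ β, IsRationalClass β → IsRationalClass (f β)) → f * ε = 0 ∨ f * ε = ε) →
        (∃ β, ¬ IsOfHodgeType (2 * (m + 1)) X (2 * (m + 1)) (m + 1) (m + 1) (ε β)) →
        (∃ z : Module.End ℂ (complexBetti X (2 * (m + 1))),
          IsPrimitiveCentralIdempotent
              (Algebra.adjoin ℂ (Set.range (D.heckeCorrespondenceAction (2 * (m + 1))))) z ∧
            z * ε = z ∧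
              ∀ σ : ℂ ≃+* ℂ, ∃ c : complexBetti X (2 * (m + 1)),
                IsOfHodgeType (2 * (m + 1)) X (2 * (m + 1)) (m + 1) (m + 1) (conjEnd σ z c) ∧
                  conjEnd σ z c ≠ 0) →
        ∀ e : complexBetti X (2 * (m + 1)), IsRationalClass e →
          IsOfHodgeType (2 * (m + 1)) X (2 * (m + 1)) (m + 1) (m + 1) e →
          (∀ x ∈ ((⨆ (W : Submodule D.E (Fin (2 * (m + 1) + 1) → D.E))
              (_ : IsTotallyPositive (conjRingHom D.E) D.H W) (_ : Module.finrank D.E W = m + 1),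
              classesSupportedOn X (D.specialSubvariety W) (2 * (m + 1))) ⊔
            (⨆ (W : Submodule D.E (Fin (2 * (m + 1) + 1) → D.E))
              (_ : IsTotallyPositive (conjRingHom D.E) D.H W) (_ : Module.finrank D.E W = m)
              (Z : Set X.left) (_ : IsClosed Z) (_ : Z ⊆ D.specialSubvariety W)
              (_ : ∀ z ∈ Z, ((m + 1 : ℕ) : ℕ∞) ≤ Order.coheight z),
              classesSupportedOn X Z (2 * (m + 1))) ⊔
            Submodule.span ℂ {z : complexBetti X (2 * (m + 1)) |
              ∃ a : complexBetti X (2 * m), IsRationalClass a ∧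
                IsOfHodgeType (2 * (m + 1)) X (2 * m) m m a ∧
                ∃ d ∈ algebraicClasses X 1,
                  z = cupProduct (two_mul_add_two_mul m 1) a d}),
            cupProduct (two_mul_add_two_mul (m + 1) (m + 1)) e x = 0) →
          ε e = 0) →
    AlgebraicOrEnveloped :=
  fun hA hcup hCV ↦
    algebraicOrEnveloped_of_algebraicKernelEnveloped_of_pure hA hcup
      (Theorems.algebraicKernelEnveloped_of_orthogonalEnveloped hcup
        (orthogonalEnveloped_of_coreVanishing_of_pure hA hcup hCV))

end Summit.HodgeConjecture.HodgeConjecture.Theorems.EndoscopicMiddleDegreeAlgebraicOrEnvelopedOfCoreVanishingPure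

end
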